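import Literature.Computability.Complexity.UniformDerandomizationDistinguisher
import Literature.Computability.Complexity.CircuitClassesUniformProofs
import Literature.Computability.Complexity.LengthCompare
import Literature.Computability.Complexity.CircuitLowerBounds
import Literature.Computability.MetaComplexity.NWPseudorandom
import HarnessLib

/-!
# Uniform tests against a Nisan–Wigderson generator: the nonuniform (circuit) bound

Literature / complexity — toolkit for the discharge-in-progress of the named fact
`impagliazzoWigderson1998_samplable` (`UniformDerandomization.lean`; van Melkebeek 2000, Thm. 6.2.1 =
Impagliazzo–Wigderson 1998, Thm. 5). `UniformDerandomizationProofs.lean` reduced the fact to a hinge on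
generators `G ℓ : {0,1}^{ℓ^{c₀}} → {0,1}^{ℓ^k}` fooling, infinitely often at every rate `1/ℓ^c`, every
probabilistic polynomial-time test `T` in the two averages `UDerand.seedAvg` (over seeds and coins) and
`UDerand.unifAvg` (over uniform strings and coins). The printed proof splits on `EXP ⊆ P/poly`
(Impagliazzo–Wigderson, §2.1: "since [BFNW] show that `BPP ⊆ i.o.-SUBEXP` assuming `EXP ⊄ P/poly`, we
can assume `EXP ⊂ P/poly`"). In the case `EXP ⊄ P/poly` the generator is the Nisan–Wigderson generator
on an `EXP`-function that is hard on average for polynomial-size CIRCUITS infinitely often, and a uniform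
test is beaten length by length through the nonuniform security of the generator: for each fixing of its
coins the test is a polynomial-size circuit (Arora–Barak, Thm. 6.6 `P ⊆ P/poly` and the hard-wiring of
Thm. 7.14), and the advantage of `T` is the average over the coins of the advantages of these circuits,
each bounded by Nisan–Wigderson's Lemma (Arora–Barak Lemma 20.15, the tree's
`MetaComplexity.abs_advantage_nwGenerator_le`). This file proves exactly that bound, for an ARBITRARY
generator `G` that agrees at length `ℓ` with an NW generator reading a prefix of the seed:

* `UDerand.testLang T`, `testLang_mem_P` — the language `{⟨x, r⟩ | T(x; r) = 1}` of a PPT test is in `P`;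
  `UDerand.testFun T ℓ c` — the deterministic test `y ↦ T(⟨1^ℓ, y⟩; c)` with the coins `c` fixed;
  **`exists_cktSize_testFun`** — it has `B₂`-circuits of size polynomial in `ℓ + |y| + |c|`
  (`exists_cktSize_boolPair_of_mem_PPoly`, `CktSize.hardwire`), and `exists_poly_cktSize_testFun` — of
  size `s_T(ℓ + |y|)` for coins within the budget;
* `UDerand.pref`, `sum_pref` — averaging a function of the first `a` seed bits over all `n ≥ a` bits;
* **`UDerand.abs_seedAvg_sub_unifAvg_le`** — if `G ℓ σ = NW^f_e(σ↾a)` for all seeds `σ ∈ {0,1}^{ℓ^{c₀}}`,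
  `e` an NW design with `ℓ^k` blocks and intersections `≤ d`, `H_avg(f) ≥ S`, `ℓ^k ≤ ε S`, and the
  fixed-coin tests of `T` have circuits of size `s` with `s + ℓ^k · univBound d + 2 ≤ S`, then
  `|seedAvg − unifAvg| ≤ ε` at `ℓ`;
* **`UDerand.frequently_abs_seedAvg_sub_unifAvg_lt`** — along the lengths: if moreover the hard
  functions `f_ℓ` are infinitely often average-case hard for EVERY polynomial size
  (`∀ c, ∃^∞ ℓ, H_avg(f_ℓ) ≥ ℓ^c`, the output of Babai–Fortnow–Nisan–Wigderson's amplification from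
  `EXP ⊄ P/poly`), then `T` is fooled infinitely often at every rate `1/ℓ^c` — the fooling clause of the
  hinge of `UniformDerandomizationProofs.lean` for this `G`.

Everything is proved; the two definitions are plain abbreviations. Nothing here duplicates the tree
(searched `testLang`, `seedAvg`, `hardwire`, `advantage_nwGenerator`): the circuit bound for a `BPP`
witness with hard-wired input is `exists_cktSize_boolPair_of_mem_PPoly` (reused), the NW bound is
`abs_advantage_nwGenerator_le` (reused); new is only the passage from the uniform test with coins to the
family of circuits and the bookkeeping of the two averages of `UniformDerandomizationDistinguisher.lean`.

## References

* [ImpagliazzoWigderson2001] R. Impagliazzo, A. Wigderson, *Randomness vs time: derandomization under a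
  uniform assumption*, JCSS 63 (2001) 672–688, §2.1 (the case `EXP ⊄ P/poly` via BFNW).
* L. Babai, L. Fortnow, N. Nisan, A. Wigderson, *BPP has subexponential time simulations unless EXPTIME
  has publishable proofs*, Comput. Complexity 3 (1993) 307–318, §4.
* [NisanWigderson1994] N. Nisan, A. Wigderson, *Hardness vs randomness*, JCSS 49 (1994), Lemma 2.4.
* [AroraBarakCC2009] S. Arora, B. Barak, *Computational Complexity: A Modern Approach*, CUP 2009,
  Thm. 6.6, proof of Thm. 7.14 (hard-wiring the coins), Lemma 20.15, Def. 20.2.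
* [TrevisanVadhan2007] L. Trevisan, S. Vadhan, Comput. Complexity 16 (2007), §2.3 (the advantage of a
  probabilistic test `T` as an average over its coins).
* [VanMelkebeek2000] D. van Melkebeek, LNCS 1950 (2000), Thm. 6.2.1 (p. 142).
-/

noncomputable section

namespace Literature.Computability.Complexity

open _root_.Computability Finset Filter Polynomial Brick Plumb MetaComplexity

namespace UDerand

variable (T : RandAlg (List Bool) Bool)

/-! ### The test language of a probabilistic test and its fixed-coin circuits -/

/-- The language `{⟨x, r⟩ | T(x; r) = 1}` of the runs of `T`. [cite: AroraBarakCC2009, Def. 7.1] -/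
def testLang : Language Bool := {w | T.run (fstF w) (sndF w) = true}

/-- The indicator of `testLang` on a pair is the verdict of the run. [folklore] -/
theorem boolIndicator_testLang (x c : List Bool) :
    (testLang T).boolIndicator (boolPair x c) = T.run x c := by
  have hmem : boolPair x c ∈ testLang T ↔ T.run x c = true := by
    show T.run (fstF (boolPair x c)) (sndF (boolPair x c)) = true ↔ _
    rw [fstF_boolPair, sndF_boolPair]
  by_cases h : T.run x c = true
  · rw [(Set.mem_iff_boolIndicator _ _).1 (hmem.2 h), h]
  · rw [Bool.not_eq_true] at h
    have hn : boolPair x c ∉ testLang T := fun hw => by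
      have hw' := hmem.1 hw
      rw [h] at hw'
      exact Bool.false_ne_true hw'
    rw [(Set.notMem_iff_boolIndicator _ _).1 hn, h]

variable {T}

/-- **`testLang T ∈ P`** for a probabilistic polynomial-time `T` (the run map composed with the
`FP` normaliser `w ↦ (w₁, w₂)`). [cite: AroraBarakCC2009, Def. 7.1 and §1.3] -/
theorem testLang_mem_P (hT : T.IsPolyTime id encodeBool) : testLang T ∈ Classes.P := by
  have hnorm : fanoutFn fstF sndF ∈ FP := fanoutFn_mem_FP fstF_mem_FP sndF_mem_FP
  have hf : PolyTimeComputable (id : List Bool → List Bool)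
      (fun p : List Bool × List Bool => boolPair p.1 p.2) (fun w : List Bool => (fstF w, sndF w)) := by
    obtain ⟨p, M, hM⟩ := hnorm
    refine ⟨p, M, fun w => ?_⟩
    simpa [fanoutFn_apply] using hM w
  have hg : (fun w : List Bool => encodeBool (T.run (fstF w) (sndF w))) ∈ FP := by
    obtain ⟨p, M, hM⟩ := PolyTimeComputable.comp_holds hT.1 hf
    exact ⟨p, M, fun w => hM w⟩
  refine mem_P_of_mem_FP hg (testLang T) fun w => ⟨fun hw => ?_, fun hw => ?_⟩
  · have hw' : T.run (fstF w) (sndF w) = true := hw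
    simp [hw', encodeBool]
  · have hw' : T.run (fstF w) (sndF w) = false := by
      cases h : T.run (fstF w) (sndF w)
      · rfl
      · exact absurd h hw
    simp [hw', encodeBool]

variable (T)

/-- **The fixed-coin test** `y ↦ T(⟨1^ℓ, y⟩; c)` on `N`-bit strings `y`.
[cite: TrevisanVadhan2007, §2.3] [cite: AroraBarakCC2009, Thm. 7.14 (proof)] -/
def testFun (ℓ : ℕ) (c : List Bool) {N : ℕ} (y : Fin N → Bool) : Bool :=
  T.run (boolPair (ones ℓ) (List.ofFn y)) c

variable {T}

/-- **The fixed-coin tests have polynomial-size circuits**: with `q` the polynomial of the circuit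
family of `testLang T` (`P ⊆ P/poly`), the test `y ↦ T(⟨1^ℓ, y⟩; c)` on `N` bits has a `B₂`-circuit of
size `(2ℓ+2+N) + ((2(2ℓ+2+N)+2+|c|) + q(2(2ℓ+2+N)+2+|c|)) + 2` (pairing wires, the `P/poly` circuit on
pairs, two constant gates for the hard-wired `1^ℓ` and `c`).
[cite: AroraBarakCC2009, Thm. 6.6 and Thm. 7.14 (proof)] -/
theorem exists_cktSize_testFun (hT : T.IsPolyTime id encodeBool) :
    ∃ q : Polynomial ℕ, ∀ (ℓ N : ℕ) (c : List Bool),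
      CktSize B2 (fun (y : Fin N → Bool) (_ : Unit) => testFun T ℓ c y)
        ((2 * ℓ + 2 + N) + ((2 * (2 * ℓ + 2 + N) + 2 + c.length) +
          q.eval (2 * (2 * ℓ + 2 + N) + 2 + c.length)) + 2) := by
  obtain ⟨q, hq⟩ := exists_cktSize_boolPair_of_mem_PPoly (P_subset_PPoly_holds (testLang_mem_P hT))
  refine ⟨q, fun ℓ N c => ?_⟩
  -- the `P/poly` circuit on pairs `(x, r)`, `|x| = 2ℓ+2+N`, `|r| = |c|`
  have h0 := hq (2 * ℓ + 2 + N) c.length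
  -- wiring `v = (y, (u, r)) ↦ (pairVec u y, r)`
  have hW1 : CktSize B2 (fun (v : Fin N ⊕ (Fin ℓ ⊕ Fin c.length) → Bool) =>
      pairVec (fun i => v (.inr (.inl i))) (fun j => v (.inl j))) (2 * ℓ + 2 + N) :=
    ((cktSize_pairVec ℓ N).rewire
      (Sum.elim (fun i => Sum.inr (Sum.inl i)) (fun j => Sum.inl j) :
        Fin ℓ ⊕ Fin N → Fin N ⊕ (Fin ℓ ⊕ Fin c.length))).congr fun _ _ => rfl
  have hW2 : CktSize B2 (fun (v : Fin N ⊕ (Fin ℓ ⊕ Fin c.length) → Bool) (j : Fin c.length) =>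
      v (.inr (.inr j))) 0 := CktSize.proj B2 _
  have hF := (hW1.pair hW2).comp h0
  have hH := hF.hardwire (Sum.elim (fun _ : Fin ℓ => true) c.get)
  refine (hH.of_le (by omega)).congr fun y u => ?_
  simp only [Sum.elim_inl, Sum.elim_inr]
  have h1 : (List.ofFn fun i : Fin (2 * ℓ + 2 + N) => pairVec (fun _ : Fin ℓ => true) (fun j => y j) i) =
      boolPair (ones ℓ) (List.ofFn y) := by
    rw [show (fun i : Fin (2 * ℓ + 2 + N) => pairVec (fun _ : Fin ℓ => true) (fun j => y j) i) =
      pairVec (fun _ : Fin ℓ => true) y from rfl, ofFn_pairVec, List.ofFn_const]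
  have h2 : (List.ofFn fun j : Fin c.length => c.get j) = c := List.ofFn_get c
  rw [h1, h2, boolIndicator_testLang, testFun]

/-- **A polynomial size bound in `ℓ + N`** for coins within the budget: there is a polynomial `s_T`
with circuits of size `≤ s_T(ℓ + N)` for every `y ↦ T(⟨1^ℓ, y⟩; c)`, `|c| ≤ coinLen(2ℓ+2+N)`.
[cite: AroraBarakCC2009, Thm. 7.14 (proof)] -/
theorem exists_poly_cktSize_testFun (hT : T.IsPolyTime id encodeBool) :
    ∃ s : Polynomial ℕ, ∀ (ℓ N : ℕ) (c : List Bool), c.length ≤ T.coinLen (2 * ℓ + 2 + N) →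
      CktSize B2 (fun (y : Fin N → Bool) (_ : Unit) => testFun T ℓ c y) (s.eval (ℓ + N)) := by
  obtain ⟨q, hq⟩ := exists_cktSize_testFun hT
  obtain ⟨p, hp⟩ := hT.2
  -- `A = 2X + 2 ≥ 2ℓ+2+N`, `B = 2A + 2 + p(A) ≥ 2(2ℓ+2+N)+2+|c|`
  refine ⟨(2 * X + 2) + ((2 * (2 * X + 2) + 2 + p.comp (2 * X + 2)) +
      q.comp (2 * (2 * X + 2) + 2 + p.comp (2 * X + 2))) + 2, fun ℓ N c hc => ?_⟩
  refine (hq ℓ N c).of_le ?_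
  have hA : 2 * ℓ + 2 + N ≤ 2 * (ℓ + N) + 2 := by omega
  have hc' : c.length ≤ p.eval (2 * (ℓ + N) + 2) :=
    hc.trans ((hp _).trans (natPoly_eval_mono p hA))
  have hB : 2 * (2 * ℓ + 2 + N) + 2 + c.length ≤ 2 * (2 * (ℓ + N) + 2) + 2 + p.eval (2 * (ℓ + N) + 2) := by
    omega
  simp only [eval_add, eval_mul, eval_ofNat, eval_X, eval_comp]
  have := natPoly_eval_mono q hB
  omega

/-! ### Averaging over the unused seed bits -/

/-- The first `a` bits of a seed of `n ≥ a` bits, as a function on `Fin a`. [folklore] -/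
def pref {n : ℕ} (a : ℕ) (h : a ≤ n) (σ : List.Vector Bool n) : Fin a → Bool := fun p => σ.get (Fin.castLE h p)

/-- The seed splits as (first `a` bits, the rest). [folklore] -/
def seedSplit {n : ℕ} (a : ℕ) (h : a ≤ n) : List.Vector Bool n ≃ (Fin a → Bool) × (Fin (n - a) → Bool) :=
  (Equiv.vectorEquivFin Bool n).trans
    ((Equiv.arrowCongr (finSumFinEquiv.trans (finCongr (Nat.add_sub_cancel' h))).symm (Equiv.refl Bool)).trans
      (Equiv.sumArrowEquivProdArrow (Fin a) (Fin (n - a)) Bool))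

/-- The first component of the split is the prefix. [folklore] -/
theorem seedSplit_fst {n : ℕ} (a : ℕ) (h : a ≤ n) (σ : List.Vector Bool n) : (seedSplit a h σ).1 = pref a h σ := by
  funext p
  simp only [seedSplit, pref, Equiv.trans_apply, Equiv.sumArrowEquivProdArrow_apply_fst, Function.comp_apply,
    Equiv.arrowCongr_apply, Equiv.refl_apply, Equiv.symm_symm, Equiv.trans_apply, finSumFinEquiv_apply_left,
    finCongr_apply, Equiv.vectorEquivFin]
  rfl

/-- **Averaging a function of the prefix**: `∑_{σ ∈ {0,1}^n} g(σ↾a) = 2^{n−a} ∑_{z ∈ {0,1}^a} g(z)`.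
[cite: AroraBarakCC2009, §7.1] -/
theorem sum_pref {n a : ℕ} (h : a ≤ n) (g : (Fin a → Bool) → ℝ) :
    ∑ σ : List.Vector Bool n, g (pref a h σ) = 2 ^ (n - a) * ∑ z : Fin a → Bool, g z := by
  classical
  rw [Fintype.sum_equiv (seedSplit a h) (fun σ => g (pref a h σ)) (fun zw => g zw.1)
    (fun σ => by rw [seedSplit_fst]), Fintype.sum_prod_type, mul_sum]
  refine sum_congr rfl fun z _ => ?_
  show ∑ _w : Fin (n - a) → Bool, g z = _
  rw [sum_const, card_univ, Fintype.card_fun, Fintype.card_bool, Fintype.card_fin, nsmul_eq_mul]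
  push_cast
  ring

/-! ### The advantage of a uniform test as an average of circuit advantages -/

/-- The acceptance probability of `T` on an input of length `nx`, as a normalised sum over the coin
vectors of length `coinLen nx`. [cite: AroraBarakCC2009, §7.1] -/
theorem pr_true_eq_sum {x : List Bool} {nx : ℕ} (hx : x.length = nx) :
    T.pr id x {true} =
      (∑ c : List.Vector Bool (T.coinLen nx), if T.run x c.toList = true then (1 : ℝ) else 0) / 2 ^ T.coinLen nx := by
  classical
  rw [RandAlg.pr_eq_uniformProb, id, hx, uniformProb_eq_sum_ite]
  refine congrArg (· / _) (sum_congr rfl fun c _ => ?_)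
  by_cases h : T.run x c.toList = true
  · simp [h]
  · simp [h]

/-- `Pr_y[D y]` over `y ∈ {0,1}^N` listed as vectors: `∑_r [D r] = 2^N · acceptProb D`. [folklore] -/
theorem sum_vector_ite_eq_acceptProb {N : ℕ} (D : (Fin N → Bool) → Bool) :
    (∑ r : List.Vector Bool N, if D r.get = true then (1 : ℝ) else 0) = 2 ^ N * acceptProb D := by
  classical
  have h1 : (∑ r : List.Vector Bool N, if D r.get = true then (1 : ℝ) else 0) =
      ∑ y : Fin N → Bool, if D y = true then (1 : ℝ) else 0 :=
    Fintype.sum_equiv (Equiv.vectorEquivFin Bool N) _ _ fun _ => rfl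
  rw [h1, acceptProb, Fintype.card_fun, Fintype.card_bool, Fintype.card_fin, sum_boole]
  push_cast
  rw [mul_div_cancel₀ _ (by positivity)]

/-- `Pr_z[D (G z)]` over `z ∈ {0,1}^a`: `∑_z [D (G z)] = 2^a · acceptProbOn D G`. [folklore] -/
theorem sum_ite_eq_acceptProbOn {a N : ℕ} (D : (Fin N → Bool) → Bool) (G' : (Fin a → Bool) → (Fin N → Bool)) :
    (∑ z : Fin a → Bool, if D (G' z) = true then (1 : ℝ) else 0) = 2 ^ a * acceptProbOn D G' := by
  classical
  rw [acceptProbOn, Fintype.card_fun, Fintype.card_bool, Fintype.card_fin, sum_boole]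
  push_cast
  rw [mul_div_cancel₀ _ (by positivity)]

/-- `ofFn` of the coordinates of a vector is its list. [folklore] -/
theorem ofFn_get_eq_toList {N : ℕ} (r : List.Vector Bool N) : List.ofFn r.get = r.toList := by
  rw [← List.Vector.toList_ofFn, List.Vector.ofFn_get]

/-- **The nonuniform bound on a uniform test.** Let `G ℓ σ = NW^f_e(σ↾a)` on all seeds
`σ ∈ {0,1}^{ℓ^{c₀}}` (`a ≤ ℓ^{c₀}`), `e` an NW design with `ℓ^k > 0` blocks and intersections `≤ d`,
`H_avg(f) ≥ S`, `ℓ^k ≤ ε S`, and let every fixed-coin test `y ↦ T(⟨1^ℓ, y⟩; c)` (coins of the budgeted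
length) have a `B₂`-circuit of size `s` with `s + ℓ^k · univBound d + 2 ≤ S`. Then
`|seedAvg − unifAvg| ≤ ε` at `ℓ`: both averages are means over the coins `c`, of `Pr_σ[T_c(G σ)]` and
`Pr_y[T_c(y)]` respectively, whose difference is the advantage of the circuit `T_c` against `NW^f_e`,
at most `ε` in absolute value by Nisan–Wigderson's lemma.
[cite: NisanWigderson1994, Lemma 2.4] [cite: AroraBarakCC2009, Lemma 20.15 and Thm. 7.14 (proof)]
[cite: ImpagliazzoWigderson2001, §2.1] -/
theorem abs_seedAvg_sub_unifAvg_le {c₀ k ℓ n a d : ℕ} {G : ℕ → List Bool → List Bool}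
    (e : Fin (ℓ ^ k) → (Fin n ↪ Fin a)) (he : IsNWDesign d e) (f : (Fin n → Bool) → Bool)
    (ha : a ≤ ℓ ^ c₀)
    (hG : ∀ σ : List.Vector Bool (ℓ ^ c₀), G ℓ σ.toList = List.ofFn (nwGenerator e f (pref a ha σ)))
    (T : RandAlg (List Bool) Bool) {s : ℕ}
    (hT : ∀ c : List Bool, c.length = T.coinLen (2 * ℓ + 2 + ℓ ^ k) →
      CktSize B2 (fun (y : Fin (ℓ ^ k) → Bool) (_ : Unit) => testFun T ℓ c y) s)
    {S ε : ℝ} (hf : AvgHardAtLeast f S) (hk : 0 < ℓ ^ k) (hε : ((ℓ ^ k : ℕ) : ℝ) ≤ ε * S)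
    (hs : ((s + ℓ ^ k * univBound d + 2 : ℕ) : ℝ) ≤ S) :
    |seedAvg c₀ k G T ℓ - unifAvg k T ℓ| ≤ ε := by
  classical
  -- the fixed-coin tests and their advantages
  have hadv : ∀ c : List.Vector Bool (T.coinLen (2 * ℓ + 2 + ℓ ^ k)),
      |advantage (fun y : Fin (ℓ ^ k) → Bool => testFun T ℓ c.toList y) (nwGenerator e f)| ≤ ε := by
    intro c
    obtain ⟨C, hB, hCs, hCe⟩ := (hT c.toList (List.Vector.toList_length c)).toCircuit
    have hfun : C.eval = fun y : Fin (ℓ ^ k) → Bool => testFun T ℓ c.toList y := funext fun y => hCe y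
    rw [← hfun]
    refine abs_advantage_nwGenerator_le e f he hf hk hε C hB (le_trans ?_ hs)
    exact_mod_cast (by omega : C.size + ℓ ^ k * univBound d + 2 ≤ s + ℓ ^ k * univBound d + 2)
  have h2n : (2 : ℝ) ^ (ℓ ^ c₀ - a) * 2 ^ a = 2 ^ ℓ ^ c₀ := by
    rw [← pow_add, Nat.sub_add_cancel ha]
  -- the seed average as a mean over the coins of `acceptProbOn`
  have hseed : seedAvg c₀ k G T ℓ =
      (∑ c : List.Vector Bool (T.coinLen (2 * ℓ + 2 + ℓ ^ k)),
        acceptProbOn (fun y : Fin (ℓ ^ k) → Bool => testFun T ℓ c.toList y) (nwGenerator e f)) /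
        2 ^ T.coinLen (2 * ℓ + 2 + ℓ ^ k) := by
    have hlen : ∀ σ : List.Vector Bool (ℓ ^ c₀),
        (boolPair (ones ℓ) (List.takeD (ℓ ^ k) (G ℓ σ.toList) false)).length = 2 * ℓ + 2 + ℓ ^ k := by
      intro σ; simp
    have htake : ∀ σ : List.Vector Bool (ℓ ^ c₀),
        List.takeD (ℓ ^ k) (G ℓ σ.toList) false = List.ofFn (nwGenerator e f (pref a ha σ)) := by
      intro σ
      rw [hG σ, List.takeD_eq_take, List.take_of_length_le (by simp)]
      simp
    have hstep : (∑ σ : List.Vector Bool (ℓ ^ c₀),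
        T.pr id (boolPair (ones ℓ) (List.takeD (ℓ ^ k) (G ℓ σ.toList) false)) {true}) =
        ∑ σ : List.Vector Bool (ℓ ^ c₀), (∑ c : List.Vector Bool (T.coinLen (2 * ℓ + 2 + ℓ ^ k)),
          if testFun T ℓ c.toList (nwGenerator e f (pref a ha σ)) = true then (1 : ℝ) else 0) /
            2 ^ T.coinLen (2 * ℓ + 2 + ℓ ^ k) := by
      refine sum_congr rfl fun σ _ => ?_
      rw [pr_true_eq_sum (hlen σ), htake σ]
      rfl
    have hinner : ∀ c : List.Vector Bool (T.coinLen (2 * ℓ + 2 + ℓ ^ k)),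
        (∑ σ : List.Vector Bool (ℓ ^ c₀),
          if testFun T ℓ c.toList (nwGenerator e f (pref a ha σ)) = true then (1 : ℝ) else 0) =
          2 ^ ℓ ^ c₀ * acceptProbOn (fun y : Fin (ℓ ^ k) → Bool => testFun T ℓ c.toList y) (nwGenerator e f) := by
      intro c
      rw [sum_pref ha (fun z => if testFun T ℓ c.toList (nwGenerator e f z) = true then (1 : ℝ) else 0),
        sum_ite_eq_acceptProbOn, ← mul_assoc, h2n]
    unfold seedAvg
    rw [hstep, ← sum_div, sum_comm, sum_congr rfl (fun c _ => hinner c), ← mul_sum]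
    have h2 : (2 : ℝ) ^ ℓ ^ c₀ ≠ 0 := by positivity
    field_simp
  -- the uniform average as a mean over the coins of `acceptProb`
  have hunif : unifAvg k T ℓ =
      (∑ c : List.Vector Bool (T.coinLen (2 * ℓ + 2 + ℓ ^ k)),
        acceptProb (fun y : Fin (ℓ ^ k) → Bool => testFun T ℓ c.toList y)) / 2 ^ T.coinLen (2 * ℓ + 2 + ℓ ^ k) := by
    have hlen : ∀ r : List.Vector Bool (ℓ ^ k), (boolPair (ones ℓ) r.toList).length = 2 * ℓ + 2 + ℓ ^ k := by
      intro r; simp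
    have hstep : (∑ r : List.Vector Bool (ℓ ^ k), T.pr id (boolPair (ones ℓ) r.toList) {true}) =
        ∑ r : List.Vector Bool (ℓ ^ k), (∑ c : List.Vector Bool (T.coinLen (2 * ℓ + 2 + ℓ ^ k)),
          if testFun T ℓ c.toList r.get = true then (1 : ℝ) else 0) / 2 ^ T.coinLen (2 * ℓ + 2 + ℓ ^ k) := by
      refine sum_congr rfl fun r _ => ?_
      rw [pr_true_eq_sum (hlen r)]
      simp only [testFun, ofFn_get_eq_toList]
    have hinner : ∀ c : List.Vector Bool (T.coinLen (2 * ℓ + 2 + ℓ ^ k)),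
        (∑ r : List.Vector Bool (ℓ ^ k), if testFun T ℓ c.toList r.get = true then (1 : ℝ) else 0) =
          2 ^ ℓ ^ k * acceptProb (fun y : Fin (ℓ ^ k) → Bool => testFun T ℓ c.toList y) := fun c =>
      sum_vector_ite_eq_acceptProb _
    unfold unifAvg
    rw [hstep, ← sum_div, sum_comm, sum_congr rfl (fun c _ => hinner c), ← mul_sum]
    have h2 : (2 : ℝ) ^ ℓ ^ k ≠ 0 := by positivity
    field_simp
  -- conclusion: the mean of the advantages
  have hpos : (0 : ℝ) < 2 ^ T.coinLen (2 * ℓ + 2 + ℓ ^ k) := by positivity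
  rw [hseed, hunif, ← sub_div, ← sum_sub_distrib, abs_div, abs_of_pos hpos, div_le_iff₀ hpos]
  calc |∑ c : List.Vector Bool (T.coinLen (2 * ℓ + 2 + ℓ ^ k)),
        (acceptProbOn (fun y : Fin (ℓ ^ k) → Bool => testFun T ℓ c.toList y) (nwGenerator e f) -
          acceptProb (fun y : Fin (ℓ ^ k) → Bool => testFun T ℓ c.toList y))|
      ≤ ∑ c : List.Vector Bool (T.coinLen (2 * ℓ + 2 + ℓ ^ k)),
        |acceptProbOn (fun y : Fin (ℓ ^ k) → Bool => testFun T ℓ c.toList y) (nwGenerator e f) -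
          acceptProb (fun y : Fin (ℓ ^ k) → Bool => testFun T ℓ c.toList y)| := abs_sum_le_sum_abs _ _
    _ ≤ ∑ _c : List.Vector Bool (T.coinLen (2 * ℓ + 2 + ℓ ^ k)), ε := sum_le_sum fun c _ => hadv c
    _ = ε * 2 ^ T.coinLen (2 * ℓ + 2 + ℓ ^ k) := by
        rw [sum_const, card_univ, card_vector, Fintype.card_bool, nsmul_eq_mul]
        push_cast
        ring

/-! ### Along the lengths: a uniform test is fooled infinitely often at every polynomial rate -/

/-- A polynomial over `ℕ` is eventually dominated by a power: `p(ℓ) ≤ ℓ^{deg p + 1}` for `ℓ ≥ p(1)`, `ℓ ≥ 1`.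
[folklore] -/
theorem eventually_eval_le_pow_succ_natDegree (p : Polynomial ℕ) :
    ∀ᶠ ℓ : ℕ in atTop, p.eval ℓ ≤ ℓ ^ (p.natDegree + 1) := by
  filter_upwards [eventually_ge_atTop (p.eval 1 + 1)] with ℓ hℓ
  calc p.eval ℓ ≤ p.eval 1 * ℓ ^ p.natDegree := natPoly_eval_le_eval_one_mul_pow p (by omega)
    _ ≤ ℓ * ℓ ^ p.natDegree := Nat.mul_le_mul_right _ (by omega)
    _ = ℓ ^ (p.natDegree + 1) := by ring

/-- **Case `EXP ⊄ P/poly` of the hinge, in generator form.** Let `G ℓ` agree, for all large `ℓ`, with the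
NW generator `NW^{f_ℓ}_{e_ℓ}` on a prefix of `a(ℓ) ≤ ℓ^{c₀}` seed bits, where `e_ℓ` is (eventually) an NW
design with `ℓ^k` blocks and intersections `≤ d(ℓ)`, `univBound (d ℓ)` polynomially bounded; and let the
hard functions be **infinitely often average-case hard for every polynomial size**:
`∀ c', ∃^∞ ℓ, H_avg(f_ℓ) ≥ ℓ^{c'}` (monomial levels: every polynomial level is eventually below one, and
`ℓ^{c'} ≥ 1` keeps the hardness predicate meaningful). Then every probabilistic polynomial-time test `T` is
fooled infinitely often at every rate: `∀ c, ∃^∞ ℓ, |seedAvg − unifAvg| < ℓ^{−c}` — at the hard lengths of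
the level `ℓ^{c'} ≥ p(ℓ) = 2ℓ^{c+k} + s_T(ℓ + ℓ^k) + ℓ^k u(ℓ) + 2` (`abs_seedAvg_sub_unifAvg_le` with
`ε = 1/(2ℓ^c)`). This is the nonuniform half of Impagliazzo–Wigderson's case analysis (the generator of
Babai–Fortnow–Nisan–Wigderson against uniform tests), short of the hardness amplification providing the
hard family. [cite: ImpagliazzoWigderson2001, §2.1] [cite: NisanWigderson1994, Lemma 2.4]
[cite: AroraBarakCC2009, Lemma 20.15] -/
theorem frequently_abs_seedAvg_sub_unifAvg_lt {c₀ k : ℕ} {G : ℕ → List Bool → List Bool}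
    {n a d : ℕ → ℕ} (e : ∀ ℓ, Fin (ℓ ^ k) → (Fin (n ℓ) ↪ Fin (a ℓ))) (f : ∀ ℓ, (Fin (n ℓ) → Bool) → Bool)
    (he : ∀ᶠ ℓ in atTop, IsNWDesign (d ℓ) (e ℓ))
    (hG : ∀ᶠ ℓ in atTop, ∃ ha : a ℓ ≤ ℓ ^ c₀, ∀ σ : List.Vector Bool (ℓ ^ c₀),
      G ℓ σ.toList = List.ofFn (nwGenerator (e ℓ) (f ℓ) (pref (a ℓ) ha σ)))
    (hd : ∃ u : Polynomial ℕ, ∀ᶠ ℓ in atTop, univBound (d ℓ) ≤ u.eval ℓ)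
    (hhard : ∀ c' : ℕ, ∃ᶠ ℓ in atTop, AvgHardAtLeast (f ℓ) ((ℓ : ℝ) ^ c'))
    {T : RandAlg (List Bool) Bool} (hT : T.IsPolyTime id encodeBool) (c : ℕ) :
    ∃ᶠ ℓ in atTop, |seedAvg c₀ k G T ℓ - unifAvg k T ℓ| < 1 / (ℓ : ℝ) ^ c := by
  obtain ⟨s, hs⟩ := exists_poly_cktSize_testFun hT
  obtain ⟨u, hu⟩ := hd
  -- the polynomial hardness level used at length `ℓ`, and a power above it
  set p : Polynomial ℕ := 2 * X ^ (c + k) + s.comp (X + X ^ k) + X ^ k * u + 2 with hp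
  have hpev : ∀ ℓ, p.eval ℓ = 2 * ℓ ^ (c + k) + s.eval (ℓ + ℓ ^ k) + ℓ ^ k * u.eval ℓ + 2 := by
    intro ℓ; simp [hp, eval_comp]
  refine (hhard (p.natDegree + 1)).mp ?_
  filter_upwards [he, hG, hu, eventually_ge_atTop 1, eventually_eval_le_pow_succ_natDegree p]
    with ℓ heℓ hGℓ huℓ hℓ hpℓ hf
  obtain ⟨ha, hGℓ⟩ := hGℓ
  have hℓR : (1 : ℝ) ≤ ℓ := by exact_mod_cast hℓ
  have hk : 0 < ℓ ^ k := pow_pos (by omega) k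
  have hℓc : (0 : ℝ) < (ℓ : ℝ) ^ c := by positivity
  have hpS : ((p.eval ℓ : ℕ) : ℝ) ≤ (ℓ : ℝ) ^ (p.natDegree + 1) := by exact_mod_cast hpℓ
  -- `ε = 1/(2ℓ^c)`
  have hε : ((ℓ ^ k : ℕ) : ℝ) ≤ 1 / (2 * (ℓ : ℝ) ^ c) * (ℓ : ℝ) ^ (p.natDegree + 1) := by
    refine le_trans ?_ (mul_le_mul_of_nonneg_left hpS (by positivity))
    rw [hpev, div_mul_eq_mul_div, one_mul, le_div_iff₀ (by positivity)]
    have h1 : ((ℓ ^ k : ℕ) : ℝ) * (2 * (ℓ : ℝ) ^ c) = ((2 * ℓ ^ (c + k) : ℕ) : ℝ) := by push_cast; ring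
    rw [h1]
    exact_mod_cast (by omega : 2 * ℓ ^ (c + k) ≤ 2 * ℓ ^ (c + k) + s.eval (ℓ + ℓ ^ k) + ℓ ^ k * u.eval ℓ + 2)
  have hS : ((s.eval (ℓ + ℓ ^ k) + ℓ ^ k * univBound (d ℓ) + 2 : ℕ) : ℝ) ≤ (ℓ : ℝ) ^ (p.natDegree + 1) := by
    refine le_trans ?_ hpS
    rw [hpev]
    have : ℓ ^ k * univBound (d ℓ) ≤ ℓ ^ k * u.eval ℓ := Nat.mul_le_mul_left _ huℓ
    exact_mod_cast (by omega : s.eval (ℓ + ℓ ^ k) + ℓ ^ k * univBound (d ℓ) + 2 ≤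
      2 * ℓ ^ (c + k) + s.eval (ℓ + ℓ ^ k) + ℓ ^ k * u.eval ℓ + 2)
  have hle := abs_seedAvg_sub_unifAvg_le (e ℓ) heℓ (f ℓ) ha hGℓ T
    (fun c' hc' => hs ℓ (ℓ ^ k) c' hc'.le) hf hk hε hS
  calc |seedAvg c₀ k G T ℓ - unifAvg k T ℓ| ≤ 1 / (2 * (ℓ : ℝ) ^ c) := hle
    _ < 1 / (ℓ : ℝ) ^ c := by
        rw [div_lt_div_iff_of_pos_left one_pos (by positivity) hℓc]
        linarith

end UDerand

end Literature.Computability.Complexity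

end
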